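import Summits.AtomisticToContinuum.Crystallization.Theorems.DisclinationRationUniformPolytypeStabilityGapPinningBootstrap

/-!
# `UniformPolytypeStability` (stmt-AtomisticToContinuum-15800), line `birth` (v2, cells): stub `stub_gapPinning` (final)

Route `DisclinationRation`, crux `UniformPolytypeStability` (uniform harmonic stability of Lennard-Jones layered
polytypes `L(a,s,z)` on the box `a ∈ [47/50, 1]`, gaps `h_m = z (m+1) − z m ∈ [39a/50, 17a/20]`), line `birth`
(lead prover-line-stmt-AtomisticToContinuum-15800-0).  This `--supports` file proves the registered stub

  `stub_gapPinning : ∀ a s z, 47/50 ≤ a → a ≤ 1 → IsHaggSeq s → HeightBox a z → ForceBalanced a s z → GapsPinned z`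

(all gaps of a force-balanced configuration in the box agree to `1/500`), along the idea card
`Ideas/constant-stress-gap-pinning.md`, from the parts `…GapPinningDefs / Sums / Forces / CellBounds / Levels / Bootstrap`:

* (B0, `…Forces`) force balance ⇒ the transmitted normal stress is constant ⇒
  `calG 1 a η_m − calG 1 a η_m' = −Σ_{t ≥ 2} (row m t − row m' t)`;
* (B1/B2, `…CellBounds / Levels / Bootstrap`) the certified slope floor `c₀`, Lipschitz constants `L_t`, word oscillations
  `osc_t`, truncation errors `τ_t` and far tail give `c₀ |η_m − η_m'| ≤ 2τ₁ + ℓ Δ + E` for every pair of planes,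
  `Δ = sup |η_k − η_k'|`;
* THE CERTIFICATE `finalCheck prm0 = true` is evaluated here by `native_decide` (exact rational / integer arithmetic,
  ≈ 4 s; this file is `--computational`): on each of six `a`-cells `500 (2τ₁ + E) ≤ c₀ − ℓ`, whence
  `Δ ≤ (2τ₁ + E)/(c₀ − ℓ) ≤ 1/500` and `|gap m − gap m'| = a |η_m − η_m'| ≤ Δ ≤ 1/500`.

Everything is `[folklore]`; nothing here closes an item (the stub supports the crux item through the line's skeleton).
-/

noncomputable section

namespace Summit.AtomisticToContinuum.Crystallization.Theorems.UniformPolytypeStabilityCells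

open scoped BigOperators
open Literature.MathematicalPhysics.StatisticalMechanics

namespace StubGapPinning

/-- **The certificate holds**: `finalCheck prm0 = true` (kernel-external evaluation by `native_decide`). [folklore] -/
theorem cert_prm0 : finalCheck prm0 = true := by
  native_decide

variable {a : ℝ} {s : ℤ → ℤ} {z : ℤ → ℝ} {P : Prm} {ac : ℚ × ℚ}

/-- The level-`1` interval in real form. [folklore] -/
theorem It_one : ((((It 1).1 : ℚ)) : ℝ) = 39 / 50 ∧ ((((It 1).2 : ℚ)) : ℝ) = 17 / 20 := by
  simp only [It]; push_cast; norm_num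

/-- **Level `1`**: `c₀ |η_m − η_m'| ≤ |calG 1 a η_m − calG 1 a η_m'| + 2 τ₁`. [folklore] -/
theorem level_one (hP : finalCheck P = true) (hac : ac ∈ P.acells) (ha : 47 / 50 ≤ a) (ha1 : a ≤ 1)
    (hlo : ((ac.1 : ℚ) : ℝ) ≤ a) (hhi : a ≤ ((ac.2 : ℚ) : ℝ)) (hz : HeightBox a z) (m m' : ℤ) :
    ((c0Of ac.2⁻¹ P.N1 (cells1 P) : ℚ) : ℝ) * |etaG a z m - etaG a z m'| ≤
      |calG 1 a (etaG a z m) - calG 1 a (etaG a z m')| + 2 * ((tauT ac.1⁻¹ P.N1 1 : ℚ) : ℝ) := by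
  obtain ⟨ha0, hia₂, hle₂, hle₁, -⟩ := acell_real hP hac ha hlo hhi
  obtain ⟨-, hN1, hcov1, hok1, -, -, hall⟩ := finalCheck_spec hP
  obtain ⟨-, -, -, hsl, -⟩ := aCellOK_spec (hall ac hac)
  have hmem : ∀ k, ((((It 1).1 : ℚ)) : ℝ) ≤ etaG a z k ∧ etaG a z k ≤ ((((It 1).2 : ℚ)) : ℝ) := fun k => by
    rw [It_one.1, It_one.2]; exact etaG_mem ha0 hz k
  have hIt : (0 : ℚ) < (It 1).1 := by simp only [It]; norm_num
  have htail : ∀ k, |calG 1 a (etaG a z k) - FN P.N1 1 a (etaG a z k)| ≤ ((tauT ac.1⁻¹ P.N1 1 : ℚ) : ℝ) := by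
    intro k
    have h := abs_calG_sub_FN_le (c := 1) (by simp) hN1 ha0 ha1 hle₁ hIt (hmem k).1 (hmem k).2
    rwa [tauT]
  set η := etaG a z m
  set η' := etaG a z m'
  -- slope by the mean value theorem, in either order
  have hslope : ((c0Of ac.2⁻¹ P.N1 (cells1 P) : ℚ) : ℝ) * |η - η'| ≤ |FN P.N1 1 a η - FN P.N1 1 a η'| := by
    rcases le_total η η' with h | h
    · have := c0_mul_sub_le hcov1 hok1 hia₂ hle₂ hsl (hmem m).1 h (hmem m').2
      rw [abs_of_nonpos (sub_nonpos.2 h), abs_sub_comm]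
      calc ((c0Of ac.2⁻¹ P.N1 (cells1 P) : ℚ) : ℝ) * -(η - η') = ((c0Of ac.2⁻¹ P.N1 (cells1 P) : ℚ) : ℝ) * (η' - η) := by
            ring
        _ ≤ FN P.N1 1 a η' - FN P.N1 1 a η := this
        _ ≤ |FN P.N1 1 a η' - FN P.N1 1 a η| := le_abs_self _
    · have := c0_mul_sub_le hcov1 hok1 hia₂ hle₂ hsl (hmem m').1 h (hmem m).2
      rw [abs_of_nonneg (sub_nonneg.2 h)]
      exact this.trans (le_abs_self _)
  have key : FN P.N1 1 a η - FN P.N1 1 a η' =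
      (calG 1 a η - calG 1 a η') - (calG 1 a η - FN P.N1 1 a η) + (calG 1 a η' - FN P.N1 1 a η') := by ring
  rw [key] at hslope
  refine hslope.trans (((abs_add_le _ _).trans (add_le_add (abs_sub _ _) le_rfl)).trans ?_)
  linarith [htail m, htail m']

/-- **The pair inequality**: `c₀ |η_m − η_m'| ≤ 2τ₁ + ℓ Δ + E` for every two planes `m, m'`. [folklore] -/
theorem pair_ineq (hP : finalCheck P = true) (hac : ac ∈ P.acells) (ha : 47 / 50 ≤ a) (ha1 : a ≤ 1)
    (hlo : ((ac.1 : ℚ) : ℝ) ≤ a) (hhi : a ≤ ((ac.2 : ℚ) : ℝ)) (hs : IsHaggSeq s) (hz : HeightBox a z)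
    (hF : ForceBalanced a s z) (m m' : ℤ) :
    ((c0Of ac.2⁻¹ P.N1 (cells1 P) : ℚ) : ℝ) * |etaG a z m - etaG a z m'| ≤
      2 * ((tauT ac.1⁻¹ P.N1 1 : ℚ) : ℝ) + ((ellOf P ac.1⁻¹ ac.2⁻¹ (tData P) : ℚ) : ℝ) * spread a z +
        ((EOf P ac.1⁻¹ ac.2⁻¹ (tData P) : ℚ) : ℝ) := by
  have ha0 : 0 < a := by linarith
  obtain ⟨hT2, -⟩ := finalCheck_spec hP
  obtain ⟨hΔ, hΔ0, -⟩ := spread_spec ha0 hz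
  set Δ := spread a z
  -- (B0): the adjacent forces differ by minus the far rows
  obtain ⟨hsum, hid⟩ := lf_succ_sub_eq ha ha1 hs hz hF m m'
  rw [lf_succ_eq ha0 hs, lf_succ_eq ha0 hs] at hid
  set d : ℕ → ℝ := fun n => row a s z m (n + 2) - row a s z m' (n + 2) with hd
  have habs : Summable fun n => |d n| := hsum.abs
  have h1 : |calG 1 a (etaG a z m) - calG 1 a (etaG a z m')| ≤ ∑' n, |d n| := by
    rw [hid, abs_neg]
    have h := norm_tsum_le_tsum_norm (f := d) (by simpa only [Real.norm_eq_abs] using habs)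
    simpa only [Real.norm_eq_abs] using h
  -- split the series at `t = T`
  have hsplit := (habs.sum_add_tsum_nat_add (P.T - 1)).symm
  have hshift : ∀ j : ℕ, |d (j + (P.T - 1))| = |row a s z m (j + (P.T + 1)) - row a s z m' (j + (P.T + 1))| := by
    intro j
    simp only [hd, show j + (P.T - 1) + 2 = j + (P.T + 1) by omega]
  simp only [hshift] at hsplit
  obtain ⟨-, hfar⟩ := tsum_far_le hP hac ha ha1 hlo hhi hz (s := s) m m'
  -- the finite part
  have hfin : ∑ n ∈ Finset.range (P.T - 1), |d n| ≤
      ((ellOf P ac.1⁻¹ ac.2⁻¹ (tData P) : ℚ) : ℝ) * Δ +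
        (((EOf P ac.1⁻¹ ac.2⁻¹ (tData P) : ℚ) : ℝ) - ((tailT ac.1⁻¹ P.T : ℚ) : ℝ)) := by
    have hterm : ∀ n ∈ Finset.range (P.T - 1), |d n| ≤
        (((n + 2 : ℕ) : ℝ)) ^ 2 * ((LT P ac.1⁻¹ ac.2⁻¹ (n + 2) : ℚ) : ℝ) * Δ +
          ((n + 2 : ℕ) : ℝ) * (((oscT P ac.1⁻¹ ac.2⁻¹ (n + 2) : ℚ) : ℝ) +
            2 * ((tauT ac.1⁻¹ (P.Nt (n + 2)) (n + 2) : ℚ) : ℝ)) := by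
      intro n hn
      have hn' := Finset.mem_range.1 hn
      exact abs_row_sub_row_le hP hac ha ha1 hlo hhi hz (s := s) (t := n + 2) (by omega) (by omega) m m' hΔ
    refine (Finset.sum_le_sum hterm).trans (le_of_eq ?_)
    rw [Finset.sum_add_distrib, ellOf_eq, EOf_eq]
    push_cast
    rw [Finset.sum_mul, add_sub_cancel_right]
  have htot : ∑' n, |d n| ≤ ((ellOf P ac.1⁻¹ ac.2⁻¹ (tData P) : ℚ) : ℝ) * Δ +
      ((EOf P ac.1⁻¹ ac.2⁻¹ (tData P) : ℚ) : ℝ) := by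
    rw [hsplit]; linarith
  have h0 := level_one hP hac ha ha1 hlo hhi hz m m'
  linarith

/-- **The bootstrap**: `Δ ≤ 1/500`. [folklore] -/
theorem spread_le (hP : finalCheck P = true) (hac : ac ∈ P.acells) (ha : 47 / 50 ≤ a) (ha1 : a ≤ 1)
    (hlo : ((ac.1 : ℚ) : ℝ) ≤ a) (hhi : a ≤ ((ac.2 : ℚ) : ℝ)) (hs : IsHaggSeq s) (hz : HeightBox a z)
    (hF : ForceBalanced a s z) : spread a z ≤ 1 / 500 := by
  have ha0 : 0 < a := by linarith
  obtain ⟨hT2, -, -, -, -, -, hall⟩ := finalCheck_spec hP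
  obtain ⟨hac0, -, -, -, hfinQ⟩ := aCellOK_spec (hall ac hac)
  obtain ⟨hΔ, hΔ0, hleast⟩ := spread_spec ha0 hz
  have hia₁ : (0 : ℚ) < ac.1⁻¹ := inv_pos.2 hac0
  have hℓ0 : (0 : ℝ) ≤ ((ellOf P ac.1⁻¹ ac.2⁻¹ (tData P) : ℚ) : ℝ) := by
    exact_mod_cast ellOf_nonneg P ac.1⁻¹ ac.2⁻¹ (tData P)
  have hτ0 : (0 : ℝ) ≤ ((tauT ac.1⁻¹ P.N1 1 : ℚ) : ℝ) := by exact_mod_cast tauT_nonneg hia₁.le _ _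
  have hE1 : (((tailT ac.1⁻¹ P.T : ℚ)) : ℝ) ≤ ((EOf P ac.1⁻¹ ac.2⁻¹ (tData P) : ℚ) : ℝ) := by
    exact_mod_cast tailT_le_EOf P hia₁.le _ _
  have hE2 : (0 : ℝ) < ((tailT ac.1⁻¹ P.T : ℚ) : ℝ) := by exact_mod_cast tailT_pos hia₁ (by omega)
  have hfin : (500 : ℝ) * (2 * ((tauT ac.1⁻¹ P.N1 1 : ℚ) : ℝ) + ((EOf P ac.1⁻¹ ac.2⁻¹ (tData P) : ℚ) : ℝ)) ≤
      ((c0Of ac.2⁻¹ P.N1 (cells1 P) : ℚ) : ℝ) - ((ellOf P ac.1⁻¹ ac.2⁻¹ (tData P) : ℚ) : ℝ) := by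
    have h : (((500 * (2 * tauT ac.1⁻¹ P.N1 1 + EOf P ac.1⁻¹ ac.2⁻¹ (tData P)) : ℚ)) : ℝ) ≤
        (((c0Of ac.2⁻¹ P.N1 (cells1 P) - ellOf P ac.1⁻¹ ac.2⁻¹ (tData P) : ℚ)) : ℝ) := by exact_mod_cast hfinQ
    push_cast at h
    exact h
  set Δ := spread a z
  set c₀ : ℝ := ((c0Of ac.2⁻¹ P.N1 (cells1 P) : ℚ) : ℝ)
  set ℓ : ℝ := ((ellOf P ac.1⁻¹ ac.2⁻¹ (tData P) : ℚ) : ℝ)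
  set S : ℝ := 2 * ((tauT ac.1⁻¹ P.N1 1 : ℚ) : ℝ) + ((EOf P ac.1⁻¹ ac.2⁻¹ (tData P) : ℚ) : ℝ) with hSdef
  have hS0 : 0 < S := by rw [hSdef]; linarith
  have hgap : 0 < c₀ - ℓ := by linarith
  have hc0 : 0 < c₀ := by linarith
  -- every difference is at most `(S + ℓ Δ)/c₀`, hence so is `Δ`
  have hpair : ∀ k k', |etaG a z k - etaG a z k'| ≤ (S + ℓ * Δ) / c₀ := by
    intro k k'
    rw [le_div_iff₀ hc0, mul_comm]
    have := pair_ineq hP hac ha ha1 hlo hhi hs hz hF k k'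
    rw [hSdef]; linarith
  have hΔ1 : Δ ≤ (S + ℓ * Δ) / c₀ := hleast _ hpair
  rw [le_div_iff₀ hc0] at hΔ1
  have hΔ2 : Δ * (c₀ - ℓ) ≤ S := by nlinarith
  have hΔ3 : Δ ≤ S / (c₀ - ℓ) := by rw [le_div_iff₀ hgap]; exact hΔ2
  refine hΔ3.trans ?_
  rw [div_le_iff₀ hgap]
  linarith

/-- **Gap pinning from a true certificate**: for every `P` with `finalCheck P = true`, force-balanced configurations in
the box have all gaps within `1/500` of each other. [folklore] -/
theorem gapsPinned_of (hP : finalCheck P = true) {a : ℝ} {s : ℤ → ℤ} {z : ℤ → ℝ} (ha : 47 / 50 ≤ a) (ha1 : a ≤ 1)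
    (hs : IsHaggSeq s) (hz : HeightBox a z) (hF : ForceBalanced a s z) : GapsPinned z := by
  have ha0 : 0 < a := by linarith
  obtain ⟨-, -, -, -, -, hcova, -⟩ := finalCheck_spec hP
  obtain ⟨ac, hac, hlo, hhi⟩ := covers_spec hcova (η := a) (by push_cast; linarith) (by push_cast; linarith)
  have hΔ := spread_le hP hac ha ha1 hlo hhi hs hz hF
  obtain ⟨hle, hΔ0, -⟩ := spread_spec ha0 hz
  intro m m'
  have hgap : ∀ k, gap z k = a * etaG a z k := fun k => by rw [etaG]; field_simp
  rw [hgap, hgap, ← mul_sub, abs_mul, abs_of_pos ha0]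
  calc a * |etaG a z m - etaG a z m'| ≤ 1 * spread a z :=
        mul_le_mul ha1 (hle m m') (abs_nonneg _) zero_le_one
    _ ≤ 1 / 500 := by rw [one_mul]; exact hΔ

end StubGapPinning

open StubGapPinning in
/-- **Stub `stub_gapPinning`** (registered signature) of the line `birth`: a force-balanced layered Lennard-Jones
polytype `L(a,s,z)` in the box (`a ∈ [47/50, 1]`, gaps in `[39a/50, 17a/20]`) has all interlayer gaps within
`1/500` of each other — force balance is the conservation of the transmitted normal stress, the adjacent-layer stress is
strictly monotone in the gap (certified slope `c₀ ≥ 6.3` at `a = 1`), the rest is gap-Lipschitz (`ℓ ≤ 2.3`) and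
word-blind, and the certificate `finalCheck prm0` closes the bootstrap on six `a`-cells. [folklore] -/
theorem stub_gapPinning : ∀ (a : ℝ) (s : ℤ → ℤ) (z : ℤ → ℝ), 47 / 50 ≤ a → a ≤ 1 → IsHaggSeq s →
    HeightBox a z → ForceBalanced a s z → GapsPinned z :=
  fun _ _ _ ha ha1 hs hz hF => gapsPinned_of cert_prm0 ha ha1 hs hz hF

end Summit.AtomisticToContinuum.Crystallization.Theorems.UniformPolytypeStabilityCells

end
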